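import Summits.PneNP.PneNP.Theorems.ResolutionUncertainty.Negative.FewCliques
import Summits.PneNP.PneNP.Theorems.ResolutionUncertainty.Negative.ExponentBounds

/-!
# `ResolutionUncertainty` (stmt-PneNP-9816): TRUE ⇒ `ε ≤ 1/2` (random-like Ramsey graphs are refuted in `n^{(1/2+o(1)) log₂ n}` lines)

Calibration lemma for the support item `Summit.PneNP.PneNP.Theses.RamseyUncertifiable.ResolutionUncertainty`,
ported from the cdisprove workfile `Cruxes/ResolutionUncertainty/Disproof.lean` (statements and proofs unchanged).

* `exists_ramsey_cheap` — for `m ≥ 2` some graph on `2^m` vertices is Ramsey at `k = 2m = k(2^m)` and BOTH its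
  clique formulas have resolution refutations with at most `budget m ≤ 2^{(m²+m)/2 + 3m + 8} = n^{(1/2+o(1)) log₂ n}`
  lines (`FewCliques.exists_ramsey_few_cliques` + the clique-count form of brute force,
  `BruteForce.exists_refutation_le_count`).
* `eps_le_half` (registered stub, binder-free) / `eps_le_half_of_with` / `not_resolutionUncertaintyWith_of_half_lt`
  — `ResolutionUncertaintyWith ε → ε ≤ 1/2`: the item is exactly the assertion that dag-like resolution cannot
  beat brute force by more than the constant in the exponent on random-like Ramsey graphs; TRUE ⇒ `0 < ε ≤ 1/2`.
[Erdos1947; folklore]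
-/

-- the mandated namespace `Summit.PneNP.PneNP.…` (summit = problem = `PneNP`) repeats `PneNP` by design
set_option linter.dupNamespace false

namespace Summit.PneNP.PneNP.Theorems.ResolutionUncertainty.Negative

open Literature.Computability.Complexity Literature.Computability.MetaComplexity
open Summit.PneNP.PneNP.Theses.RamseyUncertifiable
open Summit.PneNP.PneNP.Theorems.RegularResolutionRung.Negative (cliqueCNF)

/-! ### Numerics for the `ε ≤ 1/2` boundary -/

/-- `2^{k+4} < (k!)²` for `k ≥ 4`. -/
theorem factorial_sq_gt16 (k : ℕ) (hk : 4 ≤ k) : 2 ^ (k + 4) < k.factorial ^ 2 := by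
  induction k with
  | zero => omega
  | succ k ih =>
    rcases Nat.lt_or_ge k 4 with h | h
    · obtain rfl : k = 3 := by omega
      decide
    · have ih' := ih h
      have h4 : 2 ≤ (k + 1) ^ 2 := by nlinarith
      calc 2 ^ (k + 1 + 4) = 2 * 2 ^ (k + 4) := by ring
        _ < 2 * k.factorial ^ 2 := by omega
        _ ≤ (k + 1) ^ 2 * k.factorial ^ 2 := Nat.mul_le_mul_right _ h4
        _ = (k + 1).factorial ^ 2 := by rw [Nat.factorial_succ]; ring

/-- `4 C(n,k) < 2^{C(k,2)}` as soon as `n² ≤ 2^k`, `k ≥ 4`. -/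
theorem four_mul_choose_lt (n k : ℕ) (hk : 4 ≤ k) (hn : n ^ 2 ≤ 2 ^ k) :
    4 * n.choose k < 2 ^ k.choose 2 := by
  have hc : 2 * k.choose 2 = k * (k - 1) := by
    rw [Nat.choose_two_right]
    exact Nat.mul_div_cancel' (Nat.even_mul_pred_self k).two_dvd
  have hkk : k * (k - 1) + k = k * k := by
    have : k - 1 + 1 = k := by omega
    calc k * (k - 1) + k = k * (k - 1 + 1) := by ring
      _ = k * k := by rw [this]
  have h1 : k.factorial * n.choose k ≤ n ^ k := by
    rw [← Nat.descFactorial_eq_factorial_mul_choose]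
    exact Nat.descFactorial_le_pow n k
  have h2 : (n ^ k) ^ 2 ≤ 2 ^ (k * k) := by
    rw [← pow_mul, mul_comm, pow_mul, pow_mul]
    exact Nat.pow_le_pow_left hn k
  have key : k.factorial ^ 2 * (4 * n.choose k) ^ 2 < k.factorial ^ 2 * (2 ^ k.choose 2) ^ 2 := by
    calc k.factorial ^ 2 * (4 * n.choose k) ^ 2 = 16 * (k.factorial * n.choose k) ^ 2 := by ring
      _ ≤ 16 * (n ^ k) ^ 2 := by gcongr
      _ ≤ 16 * 2 ^ (k * k) := by gcongr
      _ = 2 ^ (k + 4) * 2 ^ (k * (k - 1)) := by rw [← hkk]; ring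
      _ < k.factorial ^ 2 * 2 ^ (k * (k - 1)) :=
          Nat.mul_lt_mul_of_pos_right (factorial_sq_gt16 k hk) (by positivity)
      _ = k.factorial ^ 2 * (2 ^ k.choose 2) ^ 2 := by rw [← pow_mul, ← hc]; ring
  have key' : (4 * n.choose k) ^ 2 < (2 ^ k.choose 2) ^ 2 := Nat.lt_of_mul_lt_mul_left key
  exact lt_of_pow_lt_pow_left₀ 2 (Nat.zero_le _) key'

/-- `2 m t ≤ m(m+1) + t(t-1)` (i.e. `(m-t)(m-t+1) ≥ 0`). -/
theorem two_mul_mul_le (m t : ℕ) : 2 * m * t ≤ m * (m + 1) + t * (t - 1) := by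
  rcases t with _ | t
  · simp
  rw [Nat.add_sub_cancel]
  rcases Nat.lt_or_ge m (t + 1) with h | h
  · obtain ⟨d, rfl⟩ := Nat.exists_eq_add_of_le (Nat.lt_succ_iff.1 h)
    have : 2 * m * (m + d + 1) + (d * d + d) = m * (m + 1) + (m + d + 1) * (m + d) := by ring
    exact le_iff_exists_add.2 ⟨_, this.symm⟩
  · obtain ⟨d, rfl⟩ := Nat.exists_eq_add_of_le h
    have : 2 * (t + 1 + d) * (t + 1) + (d * d + d) = (t + 1 + d) * (t + 1 + d + 1) + (t + 1) * t := by
      ring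
    exact le_iff_exists_add.2 ⟨_, this.symm⟩

/-- The per-level maximum: `(2^m)^t ≤ 2^{(m²+m)/2} · 2^{C(t,2)}` for every `t`. -/
theorem pow_pow_le (m t : ℕ) : (2 ^ m) ^ t ≤ 2 ^ ((m * m + m) / 2) * 2 ^ t.choose 2 := by
  rw [← pow_mul, ← pow_add]
  refine Nat.pow_le_pow_right two_pos ?_
  have h2 : (m * m + m) / 2 + t.choose 2 = (m * (m + 1) + t * (t - 1)) / 2 := by
    rw [Nat.choose_two_right, show m * m + m = m * (m + 1) by ring,
      ← Nat.add_div_of_dvd_right (Nat.even_mul_succ_self m).two_dvd]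
  rw [h2, Nat.le_div_iff_mul_le two_pos]
  calc m * t * 2 = 2 * m * t := by ring
    _ ≤ _ := two_mul_mul_le m t

/-- `2m ≤ 2^m` for `m ≥ 1`. -/
theorem two_mul_le_two_pow (m : ℕ) (hm : 1 ≤ m) : 2 * m ≤ 2 ^ m := by
  induction m with
  | zero => omega
  | succ m ih =>
    rcases Nat.lt_or_ge m 1 with h | h
    · obtain rfl : m = 0 := by omega
      decide
    · have := ih h
      have h2 : 2 ≤ 2 ^ m := by
        calc 2 = 2 ^ 1 := by norm_num
          _ ≤ 2 ^ m := Nat.pow_le_pow_right two_pos h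
      rw [pow_succ]
      omega

/-- The brute-force budget at `n = 2^m` for the few-cliques Ramsey graphs. -/
def budget (m : ℕ) : ℕ :=
  4 * ((2 ^ m + 1) * ((2 * m + 1) * (8 * (2 * m + 1) * 2 ^ ((m * m + m) / 2))))

/-- `budget m ≤ 2^{(m²+m)/2 + 3m + 8}`. -/
theorem budget_le (m : ℕ) (hm : 1 ≤ m) : budget m ≤ 2 ^ ((m * m + m) / 2 + 3 * m + 8) := by
  have h1 : 2 ^ m + 1 ≤ 2 ^ (m + 1) := by
    have := Nat.one_le_two_pow (n := m); rw [pow_succ]; omega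
  have h2 : 2 * m + 1 ≤ 2 ^ (m + 1) := by
    have := two_mul_le_two_pow m hm; have := Nat.one_le_two_pow (n := m); rw [pow_succ]; omega
  calc budget m ≤ 4 * (2 ^ (m + 1) * (2 ^ (m + 1) * (8 * 2 ^ (m + 1) * 2 ^ ((m * m + m) / 2)))) := by
        unfold budget; gcongr
    _ = 2 ^ ((m * m + m) / 2 + 3 * m + 8) := by
        rw [show (4 : ℕ) = 2 ^ 2 by norm_num, show (8 : ℕ) = 2 ^ 3 by norm_num]
        simp only [← pow_add]
        congr 1; ring

/-- **Ramsey graphs whose Ramsey-ness has cheap resolution proofs on BOTH sides.** For `m ≥ 2`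
some graph on `2^m` vertices is Ramsey at `k = 2m = k(2^m)` and both its clique formulas have
refutations with at most `budget m = 2^{m²/2 + O(m)}` lines. -/
theorem exists_ramsey_cheap (m : ℕ) (hm : 2 ≤ m) :
    ∃ E : Finset (Sym2 (Fin (2 ^ m))),
      ((gr E).CliqueFree (2 * m) ∧ (gr E)ᶜ.CliqueFree (2 * m)) ∧
      ∀ b : Bool, ∃ π : List (ResLine ℕ),
        IsResRefutation (cliqueCNF (2 ^ m) (2 * m) (adjP b E)) π ∧ π.length ≤ budget m := by
  have hn : 0 < 2 ^ m := by positivity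
  have hk : 2 * m ≤ 2 ^ m + 1 := (two_mul_le_two_pow m (by omega)).trans (Nat.le_succ _)
  have hnum : 4 * (2 ^ m).choose (2 * m) < 2 ^ (2 * m).choose 2 :=
    four_mul_choose_lt _ _ (by omega) (by rw [← pow_mul, mul_comm])
  obtain ⟨E, hR, hcount⟩ := exists_ramsey_few_cliques (2 * m) hn hk hnum
  refine ⟨E, hR, fun b => ?_⟩
  -- unsatisfiability of the formula on side `b`
  have hfree : ∀ s : Fin (2 * m) → Fin (2 ^ m), ¬ Consistent (adjP b E) s := by
    cases b
    · have h := (cliqueFree_iff_forall_not_consistent (gr E)ᶜ).1 hR.2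
      rwa [decide_gr_compl_adj] at h
    · have h := (cliqueFree_iff_forall_not_consistent (gr E)).1 hR.1
      rwa [decide_gr_adj] at h
  obtain ⟨π, hπ, hlen⟩ := exists_refutation_le_count (adjP b E) hfree
  refine ⟨π, hπ, hlen.trans ?_⟩
  unfold budget
  gcongr 4 * ((2 ^ m + 1) * ?_)
  -- `Σ_{t ≤ k} C_t ≤ (k+1) · 8(k+1) 2^{(m²+m)/2}`
  have hterm : ∀ t ∈ Finset.range (2 * m + 1),
      (cons (adjP b E) t).card ≤ 8 * (2 * m + 1) * 2 ^ ((m * m + m) / 2) := by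
    intro t ht
    have htk : t ≤ 2 * m := Nat.lt_succ_iff.1 (Finset.mem_range.1 ht)
    have h1 := hcount b t htk
    have h2 : 8 * (2 * m + 1) * (2 ^ m) ^ t ≤
        2 ^ t.choose 2 * (8 * (2 * m + 1) * 2 ^ ((m * m + m) / 2)) := by
      calc 8 * (2 * m + 1) * (2 ^ m) ^ t ≤ 8 * (2 * m + 1) * (2 ^ ((m * m + m) / 2) * 2 ^ t.choose 2) :=
            Nat.mul_le_mul_left _ (pow_pow_le m t)
        _ = 2 ^ t.choose 2 * (8 * (2 * m + 1) * 2 ^ ((m * m + m) / 2)) := by ring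
    exact Nat.le_of_mul_le_mul_left (h1.trans h2) (by positivity)
  calc ∑ t ∈ Finset.range (2 * m + 1), (cons (adjP b E) t).card
      ≤ ∑ _t ∈ Finset.range (2 * m + 1), 8 * (2 * m + 1) * 2 ^ ((m * m + m) / 2) :=
        Finset.sum_le_sum hterm
    _ = (2 * m + 1) * (8 * (2 * m + 1) * 2 ^ ((m * m + m) / 2)) := by
        rw [Finset.sum_const, Finset.card_range, smul_eq_mul]

/-- **Boundary lemma: the crux forces `ε ≤ 1/2`.** Random-like Ramsey graphs at `n = 2^m` have
both clique formulas refuted in `2^{m²/2 + O(m)} = n^{(1/2 + o(1)) log₂ n}` lines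
(`exists_ramsey_cheap`), so `ResolutionUncertaintyWith ε → ε ≤ 1/2`: any proof of the crux must
produce an exponent at most `1/2`, and the conjectured truth (`Θ(log n)` exponent with a small
constant, LPRT for the binary encoding) sits below this line. -/
theorem eps_le_half_of_with {ε : ℝ} (h : ResolutionUncertaintyWith ε) : ε ≤ 1 / 2 := by
  refine le_of_not_gt fun hε => ?_
  obtain ⟨n₀, hn⟩ := h
  set m : ℕ := max (max n₀ 2) ⌈20 / (ε - 1 / 2)⌉₊ with hm
  have hm2 : 2 ≤ m := (le_max_right _ _).trans (le_max_left _ _)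
  have hn₀ : n₀ ≤ 2 ^ m := ((le_max_left _ _).trans (le_max_left _ _)).trans (Nat.lt_two_pow_self : m < 2 ^ m).le
  have hmε : 20 ≤ (ε - 1 / 2) * m := by
    have hpos : 0 < ε - 1 / 2 := by linarith
    have h1 : (20 / (ε - 1 / 2) : ℝ) ≤ m := (Nat.le_ceil _).trans (by exact_mod_cast le_max_right _ _)
    rw [div_le_iff₀ hpos] at h1
    linarith
  obtain ⟨E, -, hcheap⟩ := exists_ramsey_cheap m hm2
  obtain ⟨π₁, hπ₁, hl₁⟩ := hcheap true
  obtain ⟨π₂, hπ₂, hl₂⟩ := hcheap false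
  have hk : kR (2 ^ m) = 2 * m := kR_two_pow m
  have hπ₁' : IsResRefutation (cliqueCNF (2 ^ m) (kR (2 ^ m)) fun u v => decide ((gr E).Adj u v)) π₁ := by
    rw [decide_gr_adj, hk]; exact hπ₁
  have hπ₂' : IsResRefutation (cliqueCNF (2 ^ m) (kR (2 ^ m)) fun u v => decide ((gr E)ᶜ.Adj u v)) π₂ := by
    rw [decide_gr_compl_adj, hk]; exact hπ₂
  have hle := hn (2 ^ m) hn₀ (gr E) π₁ π₂ hπ₁' hπ₂'
  rw [rpow_logb_two_pow] at hle
  have hB := budget_le m (by omega)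
  have hBR : (budget m : ℝ) ≤ (2 : ℝ) ^ (((m * m + m) / 2 + 3 * m + 8 : ℕ) : ℝ) := by
    rw [Real.rpow_natCast]; exact_mod_cast hB
  have hmax : max (π₁.length : ℝ) (π₂.length : ℝ) ≤ (2 : ℝ) ^ (((m * m + m) / 2 + 3 * m + 8 : ℕ) : ℝ) :=
    max_le (le_trans (by exact_mod_cast hl₁) hBR) (le_trans (by exact_mod_cast hl₂) hBR)
  have hexp : ε * m * m ≤ (((m * m + m) / 2 + 3 * m + 8 : ℕ) : ℝ) :=
    (Real.rpow_le_rpow_left_iff (by norm_num : (1 : ℝ) < 2)).1 (hle.trans hmax)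
  have hdiv : (((m * m + m) / 2 : ℕ) : ℝ) ≤ ((m * m + m : ℕ) : ℝ) / 2 := Nat.cast_div_le
  have hm1 : (2 : ℝ) ≤ m := by exact_mod_cast hm2
  push_cast at hexp hdiv
  nlinarith

/-- In particular no exponent `ε > 1/2` works in the crux. -/
theorem not_resolutionUncertaintyWith_of_half_lt {ε : ℝ} (hε : 1 / 2 < ε) :
    ¬ ResolutionUncertaintyWith ε := fun h => (not_le.2 hε) (eps_le_half_of_with h)

/-- **Boundary `ε ≤ 1/2`** (registered stub, binder-free form of `eps_le_half_of_with`). -/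
theorem eps_le_half : ∀ {ε : ℝ}, ResolutionUncertaintyWith ε → ε ≤ 1 / 2 :=
  fun h => eps_le_half_of_with h

end Summit.PneNP.PneNP.Theorems.ResolutionUncertainty.Negative
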